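import Literature.Geometry.Lorentzian.KerrConvergenceProofs
import HarnessLib

/-!
# Homogeneity of the (boosted) Kerr–Schild family under dilations

The Kerr–Schild metrics form a scale-covariant family: for `ε > 0` the dilation `x ↦ ε x` of
`ℝ⁴` satisfies `g_{εM, εa}(ε x) = g_{M,a}(x)` as bilinear forms on `ℝ⁴` (the Kerr–Schild radius is
homogeneous of degree one, `r_{εa}(εx) = ε r_a(x)`, the scalar `H = M r³/(r⁴ + a² z²)` and the
null covector `ℓ` are homogeneous of degree zero in `(M, a, x) ↦ (εM, εa, εx)`; Kerr–Schild 1965,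
§2; Visser arXiv:0706.0622, (32)–(35)); the horizon radius scales, `r₊(εM, εa) = ε r₊(M, a)`, so
`ε x ∈ Kerr.exterior (εM) (εa) ↔ x ∈ Kerr.exterior M a`; and for the boosted, translated family of
`KerrConvergence.lean` (motion `(Λ, c)`), `poincareInv Λ (ε c) (ε x) = ε poincareInv Λ c x`, whence
the same covariance for `boostedKerrExterior`, `boostedKerrBilin` and the time and radius functions
of `boostedKerrBackground`. We also record the "inverse" forms (`c • x` versus the parameters
`(c⁻¹ M, c⁻¹ a, c⁻¹ c₀)`), which are the ones consumed when a late-time chart is precomposed with a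
dilation. Everything is proved; no definitions.

## References

* R. P. Kerr, A. Schild, *A new class of vacuum solutions of the Einstein field equations* (1965),
  §2. [KerrSchild1965]
* M. Visser, *The Kerr spacetime: a brief introduction*, arXiv:0706.0622, (32)–(35). [arXiv07060622]
-/

noncomputable section

open TopologicalSpace Set

namespace Literature.Geometry.Lorentzian

namespace Kerr

/-- **`H` is homogeneous of degree zero**: `H_{εM, εa}(ε x) = H_{M,a}(x)` for `ε > 0`
(Visser arXiv:0706.0622, (33), with `r_{εa}(εx) = ε r_a(x)`). [cite: arXiv07060622, (33)] -/
theorem scalarH_smul_smul {ε : ℝ} (hε : 0 < ε) (M a : ℝ) (x : E4) :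
    scalarH (ε * M) (ε * a) (ε • x) = scalarH M a x := by
  unfold scalarH
  rw [radius_smul hε, show (ε • x) 3 = ε * x 3 by simp]
  set r := radius a x
  have hfac : (ε * r) ^ 4 + (ε * a) ^ 2 * (ε * x 3) ^ 2 = ε ^ 4 * (r ^ 4 + a ^ 2 * x 3 ^ 2) := by
    ring
  rcases eq_or_ne (r ^ 4 + a ^ 2 * x 3 ^ 2) 0 with h0 | h0
  · rw [hfac, h0, mul_zero, div_zero, div_zero]
  · have hden : (ε * r) ^ 4 + (ε * a) ^ 2 * (ε * x 3) ^ 2 ≠ 0 := by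
      rw [hfac]
      exact mul_ne_zero (by positivity) h0
    rw [div_eq_div_iff hden h0]
    ring

/-- **The Kerr–Schild family is scale covariant**: `g_{εM, εa}(ε x) = g_{M,a}(x)` as bilinear forms
on `ℝ⁴`, `ε > 0` (`g = η + 2H ℓ ⊗ ℓ` with `H`, `ℓ` homogeneous of degree zero). Kerr–Schild 1965,
§2; Visser arXiv:0706.0622, (32)–(35). [cite: KerrSchild1965, §2] -/
theorem bilin_smul_smul {ε : ℝ} (hε : 0 < ε) (M a : ℝ) (x : E4) :
    bilin (ε * M) (ε * a) (ε • x) = bilin M a x := by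
  unfold bilin
  rw [scalarH_smul_smul hε, nullCovector_smul hε]

/-- **The horizon radius scales**: `r₊(εM, εa) = ε r₊(M, a)` for `ε ≥ 0`
(`r₊ = M + √(M² − a²)`; Visser arXiv:0706.0622, (41)). [cite: arXiv07060622, (41)] -/
theorem rPlus_smul {ε : ℝ} (hε : 0 ≤ ε) (M a : ℝ) : rPlus (ε * M) (ε * a) = ε * rPlus M a := by
  unfold rPlus
  rw [show (ε * M) ^ 2 - (ε * a) ^ 2 = ε ^ 2 * (M ^ 2 - a ^ 2) by ring,
    Real.sqrt_mul (sq_nonneg ε), Real.sqrt_sq hε]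
  ring

/-- **The Kerr exterior is scale covariant**: `ε x ∈ Kerr.exterior (εM) (εa) ↔ x ∈ Kerr.exterior M a`
for `ε > 0` (`r` and `r₊` both scale by `ε`). Visser arXiv:0706.0622, (35), (41). [cite: arXiv07060622, (35)] -/
theorem smul_mem_exterior_iff {ε : ℝ} (hε : 0 < ε) (M a : ℝ) (x : E4) :
    ε • x ∈ exterior (ε * M) (ε * a) ↔ x ∈ exterior M a := by
  rw [mem_exterior, mem_exterior, radius_smul hε, rPlus_smul hε.le, max_lt_iff, max_lt_iff,
    mul_lt_mul_iff_right₀ hε]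
  exact and_congr Iff.rfl ⟨fun h ↦ pos_of_mul_pos_right h hε.le, fun h ↦ mul_pos hε h⟩

end Kerr

/-! ### The boosted, translated family -/

/-- The inverse Poincaré map is covariant under dilations: `Λ⁻¹(εx − εc) = ε Λ⁻¹(x − c)`.
O'Neill 1983, Ch. 9, p. 236 (linearity of Lorentz transformations). [folklore] -/
theorem poincareInv_smul (Λ : lorentzGroup) (c : E4) (ε : ℝ) (x : E4) :
    poincareInv Λ (ε • c) (ε • x) = ε • poincareInv Λ c x := by
  unfold poincareInv
  rw [← smul_sub, map_smul]

/-- **The boosted Kerr exterior is scale covariant**: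
`ε x ∈ boostedKerrExterior Λ (εc) (εM) (εa) ↔ x ∈ boostedKerrExterior Λ c M a`, `ε > 0`. [folklore] -/
theorem smul_mem_boostedKerrExterior_iff {ε : ℝ} (hε : 0 < ε) (Λ : lorentzGroup) (c : E4)
    (M a : ℝ) (x : E4) :
    ε • x ∈ boostedKerrExterior Λ (ε • c) (ε * M) (ε * a) ↔ x ∈ boostedKerrExterior Λ c M a := by
  rw [mem_boostedKerrExterior, mem_boostedKerrExterior, poincareInv_smul,
    Kerr.smul_mem_exterior_iff hε]

/-- **The boosted Kerr–Schild forms are scale covariant**: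
`boostedKerrBilin Λ (εc) (εM) (εa) (εx) = boostedKerrBilin Λ c M a x`, `ε > 0`. Kerr–Schild 1965, §2
(Lorentz and scale covariance of the ansatz). [cite: KerrSchild1965, §2] -/
theorem boostedKerrBilin_smul {ε : ℝ} (hε : 0 < ε) (Λ : lorentzGroup) (c : E4) (M a : ℝ) (x : E4) :
    boostedKerrBilin Λ (ε • c) (ε * M) (ε * a) (ε • x) = boostedKerrBilin Λ c M a x := by
  ext v w
  rw [boostedKerrBilin_apply, boostedKerrBilin_apply, poincareInv_smul, Kerr.bilin_smul_smul hε]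

/-- The rest-frame time of the boosted background scales: `t*_{(Λ, εc)}(εx) = ε t*_{(Λ, c)}(x)`. [folklore] -/
theorem boostedKerrBackground_time_smul (Λ : lorentzGroup) (c : E4) (M a M' a' ε : ℝ) (x : E4) :
    (boostedKerrBackground Λ (ε • c) M' a').time (ε • x) =
      ε * (boostedKerrBackground Λ c M a).time x := by
  change poincareInv Λ (ε • c) (ε • x) 0 = ε * poincareInv Λ c x 0
  rw [poincareInv_smul]
  simp

/-- The rest-frame Kerr–Schild radius of the boosted background scales:
`r_{εa}(Λ⁻¹(εx − εc)) = ε r_a(Λ⁻¹(x − c))`, `ε > 0`. [cite: arXiv07060622, (35)] -/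
theorem boostedKerrBackground_radius_smul {ε : ℝ} (hε : 0 < ε) (Λ : lorentzGroup) (c : E4)
    (M M' a : ℝ) (x : E4) :
    (boostedKerrBackground Λ (ε • c) M' (ε * a)).radius (ε • x) =
      ε * (boostedKerrBackground Λ c M a).radius x := by
  change Kerr.radius (ε * a) (poincareInv Λ (ε • c) (ε • x)) = ε * Kerr.radius a (poincareInv Λ c x)
  rw [poincareInv_smul, Kerr.radius_smul hε]

/-! ### Inverse forms: the dilate `x ↦ c x` against the parameters `(c⁻¹M, c⁻¹a, c⁻¹c₀)` -/

section Inv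

variable {c : ℝ} (hc : 0 < c) (Λ : lorentzGroup) (c₀ : E4) (M a : ℝ)
include hc

/-- `c x ∈ boostedKerrExterior Λ c₀ M a ↔ x ∈ boostedKerrExterior Λ (c⁻¹c₀) (c⁻¹M) (c⁻¹a)` (`c > 0`). [folklore] -/
theorem smul_mem_boostedKerrExterior_iff_inv (x : E4) :
    c • x ∈ boostedKerrExterior Λ c₀ M a ↔
      x ∈ boostedKerrExterior Λ (c⁻¹ • c₀) (c⁻¹ * M) (c⁻¹ * a) := by
  have h := smul_mem_boostedKerrExterior_iff hc Λ (c⁻¹ • c₀) (c⁻¹ * M) (c⁻¹ * a) x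
  rwa [smul_smul, ← mul_assoc, ← mul_assoc, mul_inv_cancel₀ hc.ne', one_smul, one_mul,
    one_mul] at h

/-- `boostedKerrBilin Λ c₀ M a (c x) = boostedKerrBilin Λ (c⁻¹c₀) (c⁻¹M) (c⁻¹a) x` (`c > 0`).
[cite: KerrSchild1965, §2] -/
theorem boostedKerrBilin_smul_inv (x : E4) :
    boostedKerrBilin Λ c₀ M a (c • x) = boostedKerrBilin Λ (c⁻¹ • c₀) (c⁻¹ * M) (c⁻¹ * a) x := by
  have h := boostedKerrBilin_smul hc Λ (c⁻¹ • c₀) (c⁻¹ * M) (c⁻¹ * a) x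
  rwa [smul_smul, ← mul_assoc, ← mul_assoc, mul_inv_cancel₀ hc.ne', one_smul, one_mul,
    one_mul] at h

/-- `t*_{(Λ,c₀)}(c x) = c t*_{(Λ, c⁻¹c₀)}(x)` for the boosted backgrounds (`c > 0`). [folklore] -/
theorem boostedKerrBackground_time_smul_inv (x : E4) :
    (boostedKerrBackground Λ c₀ M a).time (c • x) =
      c * (boostedKerrBackground Λ (c⁻¹ • c₀) (c⁻¹ * M) (c⁻¹ * a)).time x := by
  have h := boostedKerrBackground_time_smul Λ (c⁻¹ • c₀) (c⁻¹ * M) (c⁻¹ * a) M a c x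
  rwa [smul_smul, mul_inv_cancel₀ hc.ne', one_smul] at h

/-- `r`-function of the boosted backgrounds: `r_{(Λ,c₀,a)}(c x) = c r_{(Λ, c⁻¹c₀, c⁻¹a)}(x)` (`c > 0`).
[cite: arXiv07060622, (35)] -/
theorem boostedKerrBackground_radius_smul_inv (x : E4) :
    (boostedKerrBackground Λ c₀ M a).radius (c • x) =
      c * (boostedKerrBackground Λ (c⁻¹ • c₀) (c⁻¹ * M) (c⁻¹ * a)).radius x := by
  have h := boostedKerrBackground_radius_smul hc Λ (c⁻¹ • c₀) M (c⁻¹ * M) (c⁻¹ * a) x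
  rwa [smul_smul, ← mul_assoc, mul_inv_cancel₀ hc.ne', one_smul, one_mul] at h

end Inv

end Literature.Geometry.Lorentzian

end
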